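import Summits.BirchSwinnertonDyer.BirchSwinnertonDyer.Theorems.KolyvaginRoadThreeSchneiderTamAtThreeHeightLogNumeratorSplitTwoTerm
import Summits.BirchSwinnertonDyer.BirchSwinnertonDyer.Theorems.KolyvaginRoadThreeSchneiderTamAtThreeHeightLogNumeratorSecondOrderCriterion
import Summits.BirchSwinnertonDyer.BirchSwinnertonDyer.Theorems.ClassRecordThreeRegCertKernelO2Log
import Summits.BirchSwinnertonDyer.BirchSwinnertonDyer.Theorems.ClassRecordThreeRegCertKernelO3FormalLog
import Summits.BirchSwinnertonDyer.BirchSwinnertonDyer.Theorems.ClassRecordThreeRegCertKernelDeep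
import HarnessLib

/-!
# The split `3`-adic height — THE SECOND DIGIT IN CLOSED FORM: `ĥ₃^{split}(Q) ≡ R(Q) (mod 3·max)` with the
# explicit RATIONAL `R = ½(A − A²/2 + A³/3) + (b₂b₄/c₄)·den x/num x − M(z)²·(−c₆/c₄)/(½(B − B²/2 + B³/3))`,
# `A = (num x)² − 1`, `z = −x/y`, `M(z) = z + (a₁/2)z² + ((a₁² + a₂)/3)z³`, `B = N_L/c₄¹²` (Kodaira `I_ν`, `ν ≥ 2`)

HONEST FRAMING (cell `bsd-stepL`, seat `bsd-stepL-tam3-p2` g4; `--supports stmt-BirchSwinnertonDyer-19154 --as helper`):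
THEOREMS ONLY, route-free (imports the seat's route-free `…SecondOrderCriterion` = the second-order law of `ĥ_{4.1}`
at `3`, and lane A's route-free `KernelCert` series lemmas); 0 definitions, 0 named facts, 0 sorry; nothing class-wide
about Schneider's conjecture; BSD asserted nowhere. Why: the FIRST digit of the split height is dead BY CONSTRUCTION on
354 of the 961 split ∧ (ram) X11b@3 classes of lane A's table — the tabulated admissible point is `Q = 3·Q'` because
`3 ∣ c_ℓ` forces `3 ∣ m₀` (evidence SPLIT3-ROWS-v2.tsv on 19154), so `ĥ(Q) = 9ĥ(Q')` — and only the SECOND digit decides.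

THE LAW (`norm_heightSplitCoord_sub_secondMain_le_three`): `W/ℚ` minimal, multiplicative at `3`; `Q = (x, y)` rational
with `‖x‖₃ > 1`; `q ∈ ℚ₃`, `‖q‖ < 1`; `V₀ ≠ 0` with `‖log₃ q − V₀‖ ≤ 3⁻²‖V₀‖`; then
**`‖ĥ₃^{split}(Q) − R‖₃ ≤ max(3⁻¹‖x‖⁻¹, ‖A‖⁴, 3⁻²‖M(z)²(c₆/c₄)/V₀‖)`**, `R = ½P₃(A) + (b₂b₄/c₄)(den/num) − M(z)²(−c₆/c₄)/V₀`,
`P₃(t) = t − t²/2 + t³/3`. Ingredients, each one digit beyond `…SplitDigit`: the seat's second-order law of `ĥ_{4.1}`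
(g2, `norm_heightFourOneCoord_sub_padicLog_num_sub_le`); `log₃ a = ½L(a²) = ½P₃(A) + O(‖A‖⁴)` (lane A
`KernelCert.norm_padicLogSeries_add_cubic_le`); `‖log_E z − M(z)‖ ≤ 3⁻²‖z‖` (lane A `norm_padicFormalLog_sub_quartic_le`
∕ `norm_padicFormalLog_sub_self_le`; the `1/3` in `M` is the `3`-adic subtlety of the formal logarithm);
`‖C⁻² + c₆/c₄‖ ≤ 3⁻¹‖q‖ ≤ 3⁻²` (`E₄ − E₆ = 744q + O(q²)`, `3 ∣ 744`); and for THE Tate parameter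
`V₀ = ½P₃(N_L/c₄¹²)` works when `v_L + 2 ≤ 2ν` (`norm_padicLog_tateParam_sub_cubicMain_le_three`; type `I₁` needs the
third-order `j`-inversion, not in the tree).

EVIDENCE (numerics/check_second_digit_p3_v2.py on lane A's REG3CERT/v2 table, kit j249895): on all 552 in-scope split
rows at `3` (`v_L ≥ 1`, `v_L + 2 ≤ 2ν`, `τ = 2k − v_L ≥ 1`, `v₃(a² − 1) ≥ τ`) the tabulated 48-digit split height
satisfies `v₃(ĥ − R) ≥ τ + 2` — 0 violations; `v₃(R) ≤ τ + 1` (second digit decides) on 413 of them, among which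
263 + 19 rows whose point is a forced `3·Q'`.

References: [SteinWuthrich2013] §4.2 (p. 16); [SilvermanAEC2009] IV.6.3–6.4, VII.2.2; [SilvermanATAEC1994] Ch. V §1 (1.1),
Thm. V.3.1(b), Lemma V.5.1; [Iwasawa1972PadicL] §4.4; [MazurSteinTate2006] §1.
-/

noncomputable section

open scoped Classical
open Filter Topology IsUltrametricDist
open WeierstrassCurve Literature.NumberTheory.EllipticCurves
open Literature.NumberTheory.EllipticCurves.SteinWuthrich2013
open Literature.NumberTheory.EllipticCurves.TateCurve
open Literature.NumberTheory.EllipticCurves.Rank1Residual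
open Summit.BirchSwinnertonDyer.Uniform.UI.O2
open Summit.BirchSwinnertonDyer.Rank1Residual Summit.BirchSwinnertonDyer.Rank1Residual.X11b

namespace Summit.BirchSwinnertonDyer.Rank1Residual.X11b.RegMult.HeightLogNumerator

/-! ### §14 The four factors to a second digit at `p = 3` -/

section SecondDigitLemmas

/-- `‖2⁻¹‖₃ = 1`. [folklore] -/
private theorem norm_inv_two_three : ‖(2 : ℚ_[3])⁻¹‖ = 1 := by
  rw [norm_inv, show (2 : ℚ_[3]) = ((2 : ℕ) : ℚ_[3]) by norm_num, Padic.norm_natCast_eq_one_iff.mpr (by decide),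
    inv_one]

/-- `log₃ x = ½·L(u²)` with `u` the unit part of `x ≠ 0` (Iwasawa normalisation at `p = 3`). [cite: Iwasawa1972PadicL, §4.4] -/
private theorem padicLog_three_eq {x : ℚ_[3]} (hx : x ≠ 0) :
    padicLog 3 x = (2 : ℚ_[3])⁻¹ * padicLogSeries 3 ((x * ((3 : ℕ) : ℚ_[3]) ^ (-x.valuation)) ^ 2) := by
  rw [padicLog_of_ne_zero hx, show (3 : ℕ) - 1 = 2 from rfl]
  norm_num

/-- **`log₃ a` to its third term for an integer `a` prime to `3`**: `A = a² − 1`,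
`‖log₃ a − ½(A − A²/2 + A³/3)‖₃ ≤ ‖A‖⁴` (`log₃ a = ½L(a²)`, lane A's `norm_padicLogSeries_add_cubic_le`).
[cite: Iwasawa1972PadicL, §4.4] -/
theorem norm_padicLog_three_intCast_sub_cubicMain_le {a : ℤ} (ha : ¬ (3 : ℤ) ∣ a) :
    ‖padicLog 3 (a : ℚ_[3]) - (2 : ℚ_[3])⁻¹ * ((((a : ℚ_[3])) ^ 2 - 1) - (((a : ℚ_[3])) ^ 2 - 1) ^ 2 / 2 +
        (((a : ℚ_[3])) ^ 2 - 1) ^ 3 / 3)‖ ≤ ‖((a : ℚ_[3])) ^ 2 - 1‖ ^ 4 := by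
  have ha1 : ‖(a : ℚ_[3])‖ = 1 := BinaryQuartic.norm_intCast_eq_one (by exact_mod_cast ha)
  have ha0 : (a : ℚ_[3]) ≠ 0 := norm_pos_iff.mp (by rw [ha1]; exact one_pos)
  have hval : (a : ℚ_[3]).valuation = 0 := by
    have h := Padic.norm_eq_zpow_neg_valuation ha0
    rw [ha1] at h
    have h' : ((3 : ℕ) : ℝ) ^ (0 : ℤ) = ((3 : ℕ) : ℝ) ^ (-(a : ℚ_[3]).valuation) := by rw [zpow_zero]; exact h
    have := zpow_right_injective₀ (by positivity) (by norm_num) h'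
    omega
  set A : ℚ_[3] := ((a : ℚ_[3])) ^ 2 - 1 with hA
  -- `‖A‖ ≤ 1/3`
  have hAint : A = (((a ^ 2 - 1 : ℤ)) : ℚ_[3]) := by rw [hA]; push_cast; ring
  have hAlt : ‖1 - (a : ℚ_[3]) ^ 2‖ < 1 := by
    rw [norm_sub_rev]; simpa using norm_pow_sub_one_lt_one_of_norm_eq_one (p := 3) ha1
  have hAle : ‖1 - (a : ℚ_[3]) ^ 2‖ ≤ 1 / 3 := by
    have hlt : ‖(((a ^ 2 - 1 : ℤ)) : ℚ_[3])‖ < 1 := by rw [← hAint, hA, norm_sub_rev]; exact hAlt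
    have hdvd : (3 : ℤ) ∣ a ^ 2 - 1 := by exact_mod_cast Padic.norm_intCast_lt_one_iff.mp hlt
    have h := (Padic.norm_int_le_pow_iff_dvd (p := 3) (a ^ 2 - 1) 1).mpr (by simpa using hdvd)
    rw [norm_sub_rev, show (a : ℚ_[3]) ^ 2 - 1 = A from rfl, hAint]
    simpa using h
  have hcub := KernelCert.norm_padicLogSeries_add_cubic_le (y := (a : ℚ_[3]) ^ 2) hAle
  have hlog : padicLog 3 (a : ℚ_[3]) = (2 : ℚ_[3])⁻¹ * padicLogSeries 3 ((a : ℚ_[3]) ^ 2) := by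
    rw [padicLog_three_eq ha0, hval, neg_zero, zpow_zero, mul_one]
  have e : padicLog 3 (a : ℚ_[3]) - (2 : ℚ_[3])⁻¹ * (A - A ^ 2 / 2 + A ^ 3 / 3) =
      (2 : ℚ_[3])⁻¹ * (padicLogSeries 3 ((a : ℚ_[3]) ^ 2) +
        ((1 - (a : ℚ_[3]) ^ 2) + (1 - (a : ℚ_[3]) ^ 2) ^ 2 / 2 + (1 - (a : ℚ_[3]) ^ 2) ^ 3 / 3)) := by
    rw [hlog, hA]; ring
  rw [e, norm_mul, norm_inv_two_three, one_mul]
  refine hcub.trans_eq ?_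
  rw [norm_sub_rev]

variable {W : WeierstrassCurve ℚ}

/-- The coefficients of `W ⊗ ℚ_p` are `p`-adic integers for a globally minimal `W` (through Mathlib's
`integralModel`). [cite: SilvermanAEC2009, VIII.8] -/
theorem norm_baseChange_a_le_one {p : ℕ} [Fact p.Prime] [W.IsGloballyMinimal] :
    ‖(W.baseChange ℚ_[p]).a₁‖ ≤ 1 ∧ ‖(W.baseChange ℚ_[p]).a₂‖ ≤ 1 ∧ ‖(W.baseChange ℚ_[p]).a₃‖ ≤ 1 := by
  set V := W.baseChange ℚ_[p]
  refine ⟨?_, ?_, ?_⟩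
  · rw [← WeierstrassCurve.integralModel_a₁_eq ℤ_[p] V]; exact PadicInt.norm_le_one _
  · rw [← WeierstrassCurve.integralModel_a₂_eq ℤ_[p] V]; exact PadicInt.norm_le_one _
  · rw [← WeierstrassCurve.integralModel_a₃_eq ℤ_[p] V]; exact PadicInt.norm_le_one _

/-- **The formal logarithm to its `1/3`-term**: for `W/ℚ` globally minimal and a rational point with `‖x‖₃ > 1`,
`z = −x/y`, `M(z) = z + (a₁/2)z² + ((a₁² + a₂)/3)z³`: **`‖log_E(z) − M(z)‖₃ ≤ 3⁻²·‖z‖₃`** (for `‖z‖ = 3⁻¹` from lane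
A's quartic expansion, bound `3⁻⁵`; for `‖z‖ ≤ 3⁻²` from `‖log_E z − z‖ ≤ ‖z‖²`). The coefficient `(a₁² + a₂)/3` is
the `3`-adic subtlety: `‖((a₁²+a₂)/3)z³‖` can be as large as `3‖z‖³ = 3⁻²‖z‖` at level one.
[cite: SilvermanAEC2009, IV.6.3(a), IV.6.4, VII.2.2] -/
theorem norm_padicFormalLog_sub_cubicMain_le_three [W.IsElliptic] [W.IsGloballyMinimal] {x y : ℚ}
    (hxy : W.toAffine.Nonsingular x y) (hx : 1 < ‖(x : ℚ_[3])‖) :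
    ‖(W.baseChange ℚ_[3]).padicFormalLog (-(x : ℚ_[3]) / y) -
        ((-(x : ℚ_[3]) / y) + (2 : ℚ_[3])⁻¹ * (W.baseChange ℚ_[3]).a₁ * (-(x : ℚ_[3]) / y) ^ 2 +
          (3 : ℚ_[3])⁻¹ * ((W.baseChange ℚ_[3]).a₁ ^ 2 + (W.baseChange ℚ_[3]).a₂) * (-(x : ℚ_[3]) / y) ^ 3)‖ ≤
      (3 : ℝ)⁻¹ ^ 2 * ‖-(x : ℚ_[3]) / y‖ := by
  obtain ⟨hz, -⟩ := norm_neg_div_of_one_lt_norm (p := 3) hxy hx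
  set z : ℚ_[3] := -(x : ℚ_[3]) / y with hzdef
  set V := W.baseChange ℚ_[3] with hV
  obtain ⟨ha1, ha2, ha3⟩ := norm_baseChange_a_le_one (W := W) (p := 3)
  rw [← hV] at ha1 ha2 ha3
  have hz3 : ‖z‖ ≤ 1 / 3 := by simpa using hz
  have hA : ‖V.a₁ ^ 2 + V.a₂‖ ≤ 1 := by
    refine (norm_add_le_max _ _).trans (max_le ?_ ha2)
    rw [norm_pow]; exact pow_le_one₀ (norm_nonneg _) ha1
  have h2 : ‖(2 : ℚ_[3])⁻¹‖ = 1 := norm_inv_two_three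
  have h3 : ‖(3 : ℚ_[3])⁻¹‖ = 3 := by
    rw [norm_inv, show (3 : ℚ_[3]) = ((3 : ℕ) : ℚ_[3]) by norm_cast, Padic.norm_p]; norm_num
  by_cases hsmall : ‖z‖ ≤ 1 / 9
  · -- deep point: every correction term is `≤ ‖z‖² ≤ 3⁻²‖z‖`
    have hcrude := KernelCert.norm_padicFormalLog_sub_self_le V hsmall
    have hz2 : ‖z‖ ^ 2 ≤ (3 : ℝ)⁻¹ ^ 2 * ‖z‖ := by
      rw [pow_two ‖z‖]
      exact mul_le_mul_of_nonneg_right (hsmall.trans (by norm_num)) (norm_nonneg _)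
    have e : V.padicFormalLog z - (z + (2 : ℚ_[3])⁻¹ * V.a₁ * z ^ 2 + (3 : ℚ_[3])⁻¹ * (V.a₁ ^ 2 + V.a₂) * z ^ 3) =
        (V.padicFormalLog z - z) + -((2 : ℚ_[3])⁻¹ * V.a₁ * z ^ 2) + -((3 : ℚ_[3])⁻¹ * (V.a₁ ^ 2 + V.a₂) * z ^ 3) := by
      ring
    rw [e]
    refine (norm_add_le_max _ _).trans (max_le ((norm_add_le_max _ _).trans (max_le (hcrude.trans hz2) ?_)) ?_)
    · rw [norm_neg, norm_mul, norm_mul, h2, one_mul, norm_pow]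
      calc ‖V.a₁‖ * ‖z‖ ^ 2 ≤ 1 * ‖z‖ ^ 2 := mul_le_mul_of_nonneg_right ha1 (sq_nonneg _)
        _ ≤ (3 : ℝ)⁻¹ ^ 2 * ‖z‖ := by rw [one_mul]; exact hz2
    · rw [norm_neg, norm_mul, norm_mul, h3, norm_pow]
      calc 3 * ‖V.a₁ ^ 2 + V.a₂‖ * ‖z‖ ^ 3 ≤ 3 * 1 * ‖z‖ ^ 3 := by gcongr
        _ = (3 * ‖z‖) * ‖z‖ ^ 2 := by ring
        _ ≤ (3 * (1 / 9)) * ‖z‖ ^ 2 := by gcongr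
        _ ≤ 1 * ‖z‖ ^ 2 := by gcongr; norm_num
        _ ≤ (3 : ℝ)⁻¹ ^ 2 * ‖z‖ := by rw [one_mul]; exact hz2
  · -- level one: `‖z‖ = 3⁻¹`; lane A's quartic expansion, the `z⁴` term and the tail are `≤ 3⁻⁴ < 3⁻³ = 3⁻²‖z‖`
    have hzge : 1 / 9 < ‖z‖ := not_le.mp hsmall
    have hquart := KernelCert.norm_padicFormalLog_sub_quartic_le V hz3
    have hA3 : ‖V.a₁ ^ 3 + 2 * V.a₁ * V.a₂ + 2 * V.a₃‖ ≤ 1 := by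
      refine (norm_add_le_max _ _).trans (max_le ((norm_add_le_max _ _).trans (max_le ?_ ?_)) ?_)
      · rw [norm_pow]; exact pow_le_one₀ (norm_nonneg _) ha1
      · rw [norm_mul, norm_mul]
        calc ‖(2 : ℚ_[3])‖ * ‖V.a₁‖ * ‖V.a₂‖ ≤ 1 * 1 * 1 := by
              gcongr; simpa using Padic.norm_int_le_one (p := 3) 2
          _ = 1 := by norm_num
      · rw [norm_mul]
        calc ‖(2 : ℚ_[3])‖ * ‖V.a₃‖ ≤ 1 * 1 := by gcongr; simpa using Padic.norm_int_le_one (p := 3) 2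
          _ = 1 := by norm_num
    have h4 : ‖(4 : ℚ_[3])⁻¹‖ = 1 := by
      rw [norm_inv, show (4 : ℚ_[3]) = ((4 : ℕ) : ℚ_[3]) by norm_num, Padic.norm_natCast_eq_one_iff.mpr (by decide),
        inv_one]
    have hterm : ‖(4 : ℚ_[3])⁻¹ * (V.a₁ ^ 3 + 2 * V.a₁ * V.a₂ + 2 * V.a₃) * z ^ 4‖ ≤ (1 / 3) ^ 4 := by
      rw [norm_mul, norm_mul, h4, one_mul, norm_pow]
      calc ‖V.a₁ ^ 3 + 2 * V.a₁ * V.a₂ + 2 * V.a₃‖ * ‖z‖ ^ 4 ≤ 1 * (1 / 3) ^ 4 := by gcongr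
        _ = (1 / 3) ^ 4 := one_mul _
    have e : V.padicFormalLog z - (z + (2 : ℚ_[3])⁻¹ * V.a₁ * z ^ 2 + (3 : ℚ_[3])⁻¹ * (V.a₁ ^ 2 + V.a₂) * z ^ 3) =
        (V.padicFormalLog z - (z + (2 : ℚ_[3])⁻¹ * V.a₁ * z ^ 2 + (3 : ℚ_[3])⁻¹ * (V.a₁ ^ 2 + V.a₂) * z ^ 3 +
          (4 : ℚ_[3])⁻¹ * (V.a₁ ^ 3 + 2 * V.a₁ * V.a₂ + 2 * V.a₃) * z ^ 4)) +
          (4 : ℚ_[3])⁻¹ * (V.a₁ ^ 3 + 2 * V.a₁ * V.a₂ + 2 * V.a₃) * z ^ 4 := by ring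
    rw [e]
    refine (norm_add_le_max _ _).trans (max_le (hquart.trans ?_) (hterm.trans ?_))
    · calc (1 / 243 : ℝ) ≤ (3 : ℝ)⁻¹ ^ 2 * (1 / 9) := by norm_num
        _ ≤ (3 : ℝ)⁻¹ ^ 2 * ‖z‖ := by gcongr
    · calc ((1 / 3 : ℝ)) ^ 4 ≤ (3 : ℝ)⁻¹ ^ 2 * (1 / 9) := by norm_num
        _ ≤ (3 : ℝ)⁻¹ ^ 2 * ‖z‖ := by gcongr

/-- **`‖C⁻² + c₆/c₄‖₃ ≤ 3⁻¹·‖q‖₃`** at a multiplicative `3` (any `‖q‖ < 1`): `C⁻² = −(c₆/c₄)·E₄/E₆` with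
`E₄ − E₆ = 240s₃ + 504s₅ = 744q + O(q²)` and `3 ∣ 744`, `3 ∣ 240`, `9 ∣ 504` (lane A's `norm_tateS_sub_self_le`).
The first-digit file had `≤ ‖q‖`; this is the second digit. [cite: SilvermanATAEC1994, Ch. V §1 (1.1), Thm. V.3.1]
[cite: SteinWuthrich2013, §4.2] -/
theorem norm_inv_uniformisationScaleSq_add_le_three [W.IsElliptic] [W.IsGloballyMinimal] (hW : Mult W 3)
    {q : ℚ_[3]} (hq : ‖q‖ < 1) :
    ‖(uniformisationScaleSq W 3 q)⁻¹ + (W.c₆ : ℚ_[3]) / (W.c₄ : ℚ_[3])‖ ≤ 3⁻¹ * ‖q‖ := by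
  have h4 : ‖(W.c₄ : ℚ_[3])‖ = 1 := norm_c₄_eq_one_of_hasMultiplicativeReductionAtPrime hW
  have h6 : ‖(W.c₆ : ℚ_[3])‖ = 1 := norm_c₆_eq_one_of_mult hW
  have hc₄ : (W.baseChange ℚ_[3]).c₄ = (W.c₄ : ℚ_[3]) := (map_c₄ W (algebraMap ℚ ℚ_[3])).trans (eq_ratCast _ _)
  have hc₆ : (W.baseChange ℚ_[3]).c₆ = (W.c₆ : ℚ_[3]) := (map_c₆ W (algebraMap ℚ ℚ_[3])).trans (eq_ratCast _ _)
  have h12 : (12 : ℚ_[3]) ≠ 0 := by norm_num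
  have hE4n : ‖tateE4 q‖ = 1 := norm_tateE4_eq_one hq
  have hE6n : ‖tateE6 q‖ = 1 := norm_tateE6_eq_one hq
  have hE60 : tateE6 q ≠ 0 := norm_pos_iff.mp (by rw [hE6n]; exact one_pos)
  have hc40 : (W.c₄ : ℚ_[3]) ≠ 0 := norm_pos_iff.mp (by rw [h4]; exact one_pos)
  have hc60 : (W.c₆ : ℚ_[3]) ≠ 0 := norm_pos_iff.mp (by rw [h6]; exact one_pos)
  -- `E₄ − E₆ = 240 s₃ + 504 s₅ = 744 q + 240(s₃ − q) + 504(s₅ − q)`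
  have hdiff : ‖tateE6 q - tateE4 q‖ ≤ 3⁻¹ * ‖q‖ := by
    have e : tateE6 q - tateE4 q = -(744 * q + 240 * (tateS 3 q - q) + 504 * (tateS 5 q - q)) := by
      rw [tateE6, tateE4_eq]; ring
    rw [e, norm_neg]
    have h744 : ‖(744 : ℚ_[3])‖ ≤ 3⁻¹ := by
      have : ((744 : ℤ) : ℚ_[3]) = 744 := by norm_cast
      rw [← this]
      have h := (Padic.norm_int_le_pow_iff_dvd (p := 3) 744 1).mpr (by norm_num)
      simpa using h
    have h240 : ‖(240 : ℚ_[3])‖ ≤ 1 := by simpa using Padic.norm_int_le_one (p := 3) 240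
    have h504 : ‖(504 : ℚ_[3])‖ ≤ 1 := by simpa using Padic.norm_int_le_one (p := 3) 504
    have hs3 := KernelCert.norm_tateS_sub_self_le 3 hq
    have hs5 := KernelCert.norm_tateS_sub_self_le 5 hq
    have hq3 : ‖q‖ ≤ 3⁻¹ := by
      have h := (Padic.norm_le_pow_iff_norm_lt_pow_add_one q (-1)).mpr (by rw [neg_add_cancel, zpow_zero]; exact hq)
      rw [zpow_neg_one] at h; exact_mod_cast h
    have hq2 : ‖q‖ ^ 2 ≤ 3⁻¹ * ‖q‖ := by
      rw [pow_two]; exact mul_le_mul_of_nonneg_right hq3 (norm_nonneg _)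
    refine (norm_add_le_max _ _).trans (max_le ((norm_add_le_max _ _).trans (max_le ?_ ?_)) ?_)
    · rw [norm_mul]; exact mul_le_mul_of_nonneg_right h744 (norm_nonneg _)
    · rw [norm_mul]
      calc ‖(240 : ℚ_[3])‖ * ‖tateS 3 q - q‖ ≤ 1 * (3⁻¹ * ‖q‖) := mul_le_mul h240 (hs3.trans hq2) (norm_nonneg _) zero_le_one
        _ = 3⁻¹ * ‖q‖ := one_mul _
    · rw [norm_mul]
      calc ‖(504 : ℚ_[3])‖ * ‖tateS 5 q - q‖ ≤ 1 * (3⁻¹ * ‖q‖) := mul_le_mul h504 (hs5.trans hq2) (norm_nonneg _) zero_le_one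
        _ = 3⁻¹ * ‖q‖ := one_mul _
  unfold uniformisationScaleSq
  rw [tateCurve_c₄, tateCurve_c₆ h12, hc₄, hc₆]
  have e : (-tateE6 q * (W.c₄ : ℚ_[3]) / (tateE4 q * (W.c₆ : ℚ_[3])))⁻¹ + (W.c₆ : ℚ_[3]) / (W.c₄ : ℚ_[3]) =
      ((W.c₆ : ℚ_[3]) / (W.c₄ : ℚ_[3])) * (tateE6 q - tateE4 q) / tateE6 q := by
    field_simp
    ring
  rw [e, norm_div, norm_mul, norm_div, h6, h4, hE6n]
  simpa using hdiff

/-- **`log₃ q` to its third term from a unit approximation**: `q ≠ 0` with unit part `u`, `‖u₁‖ ≤ 1`,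
`B₁ = u₁² − 1 ≠ 0`, `‖B₁‖ ≤ 3⁻¹`, `‖u − u₁‖ ≤ 3⁻²‖B₁‖` ⟹ `‖log₃ q − ½(B₁ − B₁²/2 + B₁³/3)‖ ≤ 3⁻²‖B₁‖`
(`log₃ q = ½L(u²)`, `L(u²) = B − B²/2 + B³/3 + O(B⁴)` with `B = u² − 1`, `‖B − B₁‖ ≤ ‖u − u₁‖`).
[cite: Iwasawa1972PadicL, §4.4] -/
theorem norm_padicLog_three_sub_cubicMain_le_of_unit_approx {q u₁ : ℚ_[3]} (hq0 : q ≠ 0) (hu₁ : ‖u₁‖ ≤ 1)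
    (hB₁0 : u₁ ^ 2 - 1 ≠ 0) (hB₁le : ‖u₁ ^ 2 - 1‖ ≤ 1 / 3)
    (happ : ‖q * ((3 : ℕ) : ℚ_[3]) ^ (-q.valuation) - u₁‖ ≤ 3⁻¹ ^ 2 * ‖u₁ ^ 2 - 1‖) :
    ‖padicLog 3 q - (2 : ℚ_[3])⁻¹ * ((u₁ ^ 2 - 1) - (u₁ ^ 2 - 1) ^ 2 / 2 + (u₁ ^ 2 - 1) ^ 3 / 3)‖ ≤
      3⁻¹ ^ 2 * ‖u₁ ^ 2 - 1‖ := by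
  set u : ℚ_[3] := q * ((3 : ℕ) : ℚ_[3]) ^ (-q.valuation) with hu
  set B₁ : ℚ_[3] := u₁ ^ 2 - 1 with hB₁
  set B : ℚ_[3] := u ^ 2 - 1 with hB
  have hun : ‖u‖ = 1 := norm_mul_zpow_neg_valuation hq0
  have hB₁pos : 0 < ‖B₁‖ := norm_pos_iff.mpr hB₁0
  set δ : ℝ := 3⁻¹ ^ 2 * ‖B₁‖ with hδ
  -- `‖B − B₁‖ ≤ ‖u − u₁‖ ≤ δ`
  have hBB₁ : ‖B - B₁‖ ≤ δ := by
    have e : B - B₁ = (u - u₁) * (u + u₁) := by rw [hB, hB₁]; ring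
    rw [e, norm_mul]
    have hsum : ‖u + u₁‖ ≤ 1 := (norm_add_le_max _ _).trans (max_le hun.le hu₁)
    calc ‖u - u₁‖ * ‖u + u₁‖ ≤ δ * 1 := mul_le_mul happ hsum (norm_nonneg _) (by positivity)
      _ = δ := mul_one _
  have hδlt : δ < ‖B₁‖ := by
    rw [hδ]
    calc (3 : ℝ)⁻¹ ^ 2 * ‖B₁‖ < 1 * ‖B₁‖ := mul_lt_mul_of_pos_right (by norm_num) hB₁pos
      _ = ‖B₁‖ := one_mul _
  have hBn : ‖B‖ = ‖B₁‖ := by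
    have hlt : ‖B - B₁‖ < ‖B₁‖ := hBB₁.trans_lt hδlt
    have h := norm_add_eq_max_of_norm_ne_norm hlt.ne'
    rw [add_sub_cancel, max_eq_left hlt.le] at h
    exact h
  have hBle : ‖1 - u ^ 2‖ ≤ 1 / 3 := by rw [norm_sub_rev, show u ^ 2 - 1 = B from rfl, hBn]; exact hB₁le
  -- `L(u²) = B − B²/2 + B³/3 + O(B⁴)`
  have hcub := KernelCert.norm_padicLogSeries_add_cubic_le (y := u ^ 2) hBle
  have hlog : padicLog 3 q = (2 : ℚ_[3])⁻¹ * padicLogSeries 3 (u ^ 2) := padicLog_three_eq hq0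
  -- replace `B` by `B₁` in the cubic main term
  have h2n : ‖(2 : ℚ_[3])⁻¹‖ = 1 := norm_inv_two_three
  have h3n : ‖(3 : ℚ_[3])⁻¹‖ = 3 := by
    rw [norm_inv, show (3 : ℚ_[3]) = ((3 : ℕ) : ℚ_[3]) by norm_cast, Padic.norm_p]; norm_num
  have hBle1 : ‖B₁‖ ≤ 1 := hB₁le.trans (by norm_num)
  have hBle' : ‖B‖ ≤ 1 := hBn ▸ hBle1
  have hP : ‖(B - B ^ 2 / 2 + B ^ 3 / 3) - (B₁ - B₁ ^ 2 / 2 + B₁ ^ 3 / 3)‖ ≤ δ := by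
    have e : (B - B ^ 2 / 2 + B ^ 3 / 3) - (B₁ - B₁ ^ 2 / 2 + B₁ ^ 3 / 3) =
        (B - B₁) + -((2 : ℚ_[3])⁻¹ * ((B - B₁) * (B + B₁))) +
          (3 : ℚ_[3])⁻¹ * ((B - B₁) * (B ^ 2 + B * B₁ + B₁ ^ 2)) := by ring
    rw [e]
    refine (norm_add_le_max _ _).trans (max_le ((norm_add_le_max _ _).trans (max_le hBB₁ ?_)) ?_)
    · rw [norm_neg, norm_mul, h2n, one_mul, norm_mul]
      have hs : ‖B + B₁‖ ≤ 1 := (norm_add_le_max _ _).trans (max_le hBle' hBle1)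
      calc ‖B - B₁‖ * ‖B + B₁‖ ≤ δ * 1 := mul_le_mul hBB₁ hs (norm_nonneg _) (by positivity)
        _ = δ := mul_one _
    · rw [norm_mul, h3n, norm_mul]
      have hsq : ‖B ^ 2 + B * B₁ + B₁ ^ 2‖ ≤ ‖B₁‖ ^ 2 := by
        refine (norm_add_le_max _ _).trans (max_le ((norm_add_le_max _ _).trans (max_le ?_ ?_)) ?_)
        · rw [norm_pow, hBn]
        · rw [norm_mul, hBn, pow_two]
        · rw [norm_pow]
      calc 3 * (‖B - B₁‖ * ‖B ^ 2 + B * B₁ + B₁ ^ 2‖) ≤ 3 * (δ * ‖B₁‖ ^ 2) := by gcongr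
        _ = δ * (3 * ‖B₁‖ ^ 2) := by ring
        _ ≤ δ * 1 := by
            refine mul_le_mul_of_nonneg_left ?_ (by positivity)
            calc 3 * ‖B₁‖ ^ 2 ≤ 3 * (1 / 3) ^ 2 := by gcongr
              _ ≤ 1 := by norm_num
        _ = δ := mul_one _
  have hB4 : ‖B‖ ^ 4 ≤ δ := by
    rw [hBn, hδ, show ‖B₁‖ ^ 4 = ‖B₁‖ ^ 3 * ‖B₁‖ by ring]
    refine mul_le_mul_of_nonneg_right ?_ (norm_nonneg _)
    calc ‖B₁‖ ^ 3 ≤ (1 / 3 : ℝ) ^ 3 := by gcongr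
      _ ≤ (3 : ℝ)⁻¹ ^ 2 := by norm_num
  -- assemble: `log₃ q − ½P₃(B₁) = ½·[(L(u²) + (t + t²/2 + t³/3)) + (P₃(B) − P₃(B₁))]`, `t = 1 − u²`
  have e : padicLog 3 q - (2 : ℚ_[3])⁻¹ * (B₁ - B₁ ^ 2 / 2 + B₁ ^ 3 / 3) =
      (2 : ℚ_[3])⁻¹ * ((padicLogSeries 3 (u ^ 2) + ((1 - u ^ 2) + (1 - u ^ 2) ^ 2 / 2 + (1 - u ^ 2) ^ 3 / 3)) +
        ((B - B ^ 2 / 2 + B ^ 3 / 3) - (B₁ - B₁ ^ 2 / 2 + B₁ ^ 3 / 3))) := by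
    rw [hlog, hB]; ring
  rw [e, norm_mul, h2n, one_mul]
  refine (norm_add_le_max _ _).trans (max_le (hcub.trans ?_) hP)
  rw [norm_sub_rev, show u ^ 2 - 1 = B from rfl]
  exact hB4

end SecondDigitLemmas

end Summit.BirchSwinnertonDyer.Rank1Residual.X11b.RegMult.HeightLogNumerator

end
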